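import Literature.NumberTheory.ModularForms.PoincareSeriesWeightTwoL2OfGram
import Literature.NumberTheory.ModularForms.PoincareSeriesWeightTwoGramLimit
import HarnessLib

/-!
# Hecke's limit in the Petersson norm: `yˢ P_m(·,s) → Σ p_m(n) e(nz)` in `L²(Γ₀(N)\ℍ)` (stub T4
# `HeckeL2` of the I1 skeleton, PROVED at every level `N`)

Topic `Literature/NumberTheory/ModularForms` (namespace `Literature.NumberTheory.ModularForms.PoincareWeightTwo`).
THEOREMS ONLY; no definition, no named fact. For `N, m ≥ 1`, with `E_s(z) = (Im z)ˢ P_m(z,s)` the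
Hecke-regularised weight-2 Poincaré series (Iwaniec–Kowalski §14.1 (14.4), §3.2) and
`Q_m = poincareQSeries N m` the `q`-series with the printed coefficients (Lemma 14.2 at `k = 2`):

* `heckeL2` — **(a)** `Q_m` is square-integrable on `Γ₀(N)\ℍ`, **(b)** so is every `E_s`, `s > 0`,
  **(c)** `Re⟪E_s − Q_m, E_s − Q_m⟫ → 0` as `s → 0⁺` — the body of the Prop `HeckeL2` of the I1 fact
  skeleton `Summits/Parity/GeneralizedHardyLittlewood/Cruxes/PeterssonBoundPrinted/Lines/poincare_hecke.lean`
  (Kowalski–Michel 2000 Petersson formula, crux item stmt-Parity-20404), VERBATIM and unconditional.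

Proof (Selberg's `L²` form of Hecke's limit): the Gram pairings `⟪E_s, E_{s'}⟫` unfold to the
`m`-th Fourier mode and converge jointly as `(s,s') → (0⁺,0⁺)` (`tendsto_gram_peterssonPairing`,
`…GramLimit.lean`, with the cell decay of `…CellDecay.lean` — no expansion at the other cusps), so
the family is `L²`-Cauchy; Fatou against the pointwise limit `E_s → Q_m` (T2 + T3, `…FourierModes`,
`…HeckeLimit`) gives (a) and (c) (`heckeL2_at_of_gram_limit`, `…L2OfGram.lean`, seat w2); (b) is the
sup bound `(Im)^{1+s}|P_m| ≤ K` (`…HeckeSqIntegrable.lean`).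

* `heckeL2_of_hyps` — the same in the registered stub shape
  `HeckeConvergence → HeckeFourierModes → HeckeUnfolding → HeckeL2` (hypotheses unused: T1, T2, U are
  theorems of the tree).

Cell `landau-siegel` / `ls-inputs` (D-0154 (2)), seat `ls-inputs-I1-w1`. «The programme SEARCHES and
TYPES; no claim about Landau–Siegel zeros until a kernel theorem says so.»

## References

* [IwaniecKowalski2004] H. Iwaniec, E. Kowalski, *Analytic Number Theory*, AMS Colloq. Publ. 53,
  §14.1–§14.2 (Lemmas 14.2–14.3), §3.2 (Hecke's trick).
* [Iwaniec2002] H. Iwaniec, *Spectral Methods of Automorphic Forms*, §3.2, §7.1.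
-/

noncomputable section

open scoped MatrixGroups Real Topology
open CongruenceSubgroup Complex MeasureTheory Filter
open UpperHalfPlane hiding I

namespace Literature.NumberTheory.ModularForms.PoincareWeightTwo

/-- **Hecke's limit in the weight-2 Petersson norm of `Γ₀(N)\ℍ` (stub T4 `HeckeL2` of the I1 skeleton
`poincare_hecke`, PROVED, every level `N ≥ 1`, every `m ≥ 1`):** (a) `poincareQSeries N m` is
square-integrable; (b) `yˢ P_m(·,s)` is square-integrable for every `s > 0`; (c)
`Re⟪yˢP_m(·,s) − Q_m, yˢP_m(·,s) − Q_m⟫ → 0` as `s → 0⁺`.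
[cite: IwaniecKowalski2004, §14.1–§14.2 (Lemmas 14.2–14.3, k = 2 with Hecke's trick §3.2)] -/
theorem heckeL2 :
    ∀ (N : ℕ) [NeZero N] (m : ℕ), 1 ≤ m →
      PeterssonSqIntegrable N 2 (poincareQSeries N m) ∧
      (∀ s : ℝ, 0 < s →
        PeterssonSqIntegrable N 2 (fun z : ℍ ↦ ((z.im ^ s : ℝ) : ℂ) * poincareHecke N m s z)) ∧
      Tendsto (fun s : ℝ ↦ (peterssonPairing N 2
          (fun z : ℍ ↦ ((z.im ^ s : ℝ) : ℂ) * poincareHecke N m s z - poincareQSeries N m z)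
          (fun z : ℍ ↦ ((z.im ^ s : ℝ) : ℂ) * poincareHecke N m s z - poincareQSeries N m z)).re)
        (𝓝[>] 0) (𝓝 0) :=
  fun N _ _ hm ↦ heckeL2_at_of_gram_limit N hm _ (tendsto_gram_peterssonPairing hm)

/-- The same in the shape of the registered stub `stub_heckeL2 : HeckeConvergence → HeckeFourierModes →
HeckeUnfolding → HeckeL2` of the skeleton (the three hypotheses — bodies of T1, T2, U — are theorems
of the tree and are not used). [cite: IwaniecKowalski2004, §14.1–§14.2 (k = 2, Hecke's trick §3.2)] -/
theorem heckeL2_of_hyps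
    (_hT1 : ∀ (N : ℕ) [NeZero N] (m : ℕ), 1 ≤ m → ∀ (s : ℝ), 0 < s → ∀ z : ℍ,
      Summable (fun v : Row N ↦ poincareTerm N m s v z) ∧
      ∀ γ : SL(2, ℤ), γ ∈ Gamma0 N →
        poincareHecke N m s (γ • z) =
          (rowDenom ((γ : Matrix (Fin 2) (Fin 2) ℤ) 1) z) ^ 2 *
            ((‖rowDenom ((γ : Matrix (Fin 2) (Fin 2) ℤ) 1) z‖ ^ (2 * s) : ℝ) : ℂ) *
              poincareHecke N m s z)
    (_hT2 : ∀ (N : ℕ) [NeZero N] (m : ℕ), 1 ≤ m → ∀ (s : ℝ), 0 < s → ∀ (n : ℤ) (y : ℝ), 0 < y →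
      Summable (fun r : ℕ ↦ ‖cellTerm N m s n y r‖) ∧
      ∫ x in (0 : ℝ)..1, poincareHecke N m s (UpperHalfPlane.ofComplex ((x : ℂ) + y * I)) *
          cexp (-(2 * π * I * n * x)) =
        (if n = (m : ℤ) then cexp (-(2 * π * m * y)) else 0) + ∑' r : ℕ, cellTerm N m s n y r)
    (_hU : ∀ (N : ℕ) [NeZero N] (m : ℕ), 1 ≤ m → ∀ (s : ℝ), 0 < s → ∀ f : CuspForm (Gamma0 N) 2,
      peterssonPairing N 2 (fun z : ℍ ↦ ((z.im ^ s : ℝ) : ℂ) * poincareHecke N m s z) ⇑f =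
        ((Real.Gamma (s + 1) / (4 * π * m) ^ (s + 1) : ℝ) : ℂ) *
          Literature.NumberTheory.EllipticCurves.ModularForms.cuspCoeff f m) :
    ∀ (N : ℕ) [NeZero N] (m : ℕ), 1 ≤ m →
      PeterssonSqIntegrable N 2 (poincareQSeries N m) ∧
      (∀ s : ℝ, 0 < s →
        PeterssonSqIntegrable N 2 (fun z : ℍ ↦ ((z.im ^ s : ℝ) : ℂ) * poincareHecke N m s z)) ∧
      Tendsto (fun s : ℝ ↦ (peterssonPairing N 2
          (fun z : ℍ ↦ ((z.im ^ s : ℝ) : ℂ) * poincareHecke N m s z - poincareQSeries N m z)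
          (fun z : ℍ ↦ ((z.im ^ s : ℝ) : ℂ) * poincareHecke N m s z - poincareQSeries N m z)).re)
        (𝓝[>] 0) (𝓝 0) :=
  heckeL2

end Literature.NumberTheory.ModularForms.PoincareWeightTwo

end
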